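import Summits.Parity.BatemanHorn.Theses.AlmostPrimeZeros
import Summits.Parity.BatemanHorn.Theorems.DiscMajorantLog.Negative.FalseWithoutPairwise
import Summits.Parity.BatemanHorn.Theorems.NormalFamilyBound.Negative.Uniformity

/-!
# Crux `DiscMajorantLog` (stmt-Parity-17114) — natural strengthenings / variants / approaches REFUTED

Negative-side theorems (standing disprover `cdisprove-stmt-Parity-17114`, 2026-08-17) for the near leaf
`Summit.Parity.BatemanHorn.Theses.AlmostPrimeZeros.DiscMajorantLog` of route `AlmostPrimeZeros`
(`‖S_x(z)‖ ≤ A x (log x)^{k(Re z−1)} e^{C‖z−1‖ log(‖z−1‖+2)}` on `‖z − 1‖ ≤ 3 log log x`, `x ≥ x₀(f)`):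

* `not_discMajorantLog_uniform` — the constants `A, C, x₀` CANNOT be chosen uniformly in the system,
  already over the degree-one systems `(X + c)`, `k = 1`, at one `x` and the real point `z = 2`
  (translate a product of `m` distinct primes onto `n = x`: `S_x(2) ≥ 2^m`).  The crux lets them depend
  on `f`; any proof must let them depend on the HEIGHT of `f`, not only on `k` and the degrees
  (cf. `…NormalFamilyBound.Negative.not_normalFamilyBound_uniform` for the sibling crux).
* `not_discMajorantLog_uncapped` — the CAP `min(v, 2)` is load-bearing: with the full multiplicity
  `Ω_f(n) = Σ_i Σ_{p^v ∥ f_i(n)} v` the majorant fails for `k = 1`, `f = (X)` at `z = 3` (inside the disc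
  once `x ≥ 16`): the single term `n = 2^j` gives `3^j ≈ x^{1.58}` against a budget `O(x (log x)^2)` —
  the pole of the `Ω`-Euler factor at `p = 2`, `|z| > 2`, which the capped (polynomial) local factors
  do not have.  A proof treating `z^{s_f(n)}` merely as a TW-class weight with `|g(p^v)| ≤ |z|^v` cannot
  cover the disc; the cap must enter.
* `budget_false_of_eq_at_neg_one` + `not_discMajorantLog_abs` — NO PROOF THROUGH THE TRIANGLE INEQUALITY,
  for every system with `k ≥ 1` (Bateman–Horn or not): `Σ_n ‖z‖^{s_f(n)}` is `x + 1` at `z = −1` against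
  `O(x (log x)^{−2k})`; all of the crux's saving over sizes (`(log x)^{k(1−cos θ)}` at `e^{iθ}`,
  `(log x)^{2kt}` at `−t`) is cancellation among phases.

Helpers: `card_primeFactors_le_capped` (`ω(n) ≤ s(n)`), `uncapped_two_pow` (`Ω(2^j) = j`).
-/

noncomputable section


namespace Summit.Parity.BatemanHorn.Theorems.DiscMajorantLog.Negative

open Polynomial Filter
open Literature.NumberTheory.Sieve
open Summit.Parity.BatemanHorn.Theorems.NormalFamilyBound.Negative (isBatemanHornSystem_fXadd)

/-! ## Statistic bookkeeping -/

/-- `ω(n) ≤ s(n)`: every prime factor contributes at least `min(v, 2) ≥ 1` to the capped statistic. [folklore] -/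
theorem card_primeFactors_le_capped (n : ℕ) :
    n.primeFactors.card ≤ n.factorization.sum (fun _ v => min v 2) := by
  unfold Finsupp.sum
  rw [Nat.support_factorization, Finset.card_eq_sum_ones]
  refine Finset.sum_le_sum fun p hp => ?_
  have : n.factorization p ≠ 0 := by
    rw [← Finsupp.mem_support_iff, Nat.support_factorization]; exact hp
  show 1 ≤ min (n.factorization p) 2
  omega

/-- `Ω(2^j) = j` for the UNCAPPED statistic. [folklore] -/
theorem uncapped_two_pow (j : ℕ) : ((2 ^ j : ℕ)).factorization.sum (fun _ v => v) = j := by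
  rw [Nat.Prime.factorization_pow Nat.prime_two, Finsupp.sum_single_index rfl]

/-! ## REFUTED STRENGTHENING 1: constants uniform in the system -/

/-- **Uniform constants are impossible.**  `DiscMajorantLog` with `∃ A C x₀` pulled in front of `∀ (k, f)`
is FALSE, already on degree-one systems `(X + c)` with `k = 1`, at ONE admissible `x` (`x = max x₀ 16`)
and the real point `z = 2` (`‖z − 1‖ = 1 ≤ 3 log log x`): the budget there is a fixed real number `R`,
while the translate `c = P − x` with `P` a product of `m` distinct primes puts the value `P` at `n = x`,
so `S_x(2) ≥ 2^{s(P)} ≥ 2^{ω(P)} = 2^m > R` for `m` large.  So `A, C, x₀` must depend on (the height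
of) `f`, not only on `k` and the degrees — the crude shadow of `Literature.Barriers.Parity.UniformBatemanHornBarrier`;
the crux, whose constants depend on `f`, is untouched. [folklore] -/
theorem not_discMajorantLog_uniform :
    ¬ ∃ A C : ℝ, ∃ x₀ : ℕ, ∀ (k : ℕ) (f : Fin k → ℤ[X]), IsBatemanHornSystem f →
      ∀ x : ℕ, x₀ ≤ x → ∀ z : ℂ, ‖z - 1‖ ≤ 3 * Real.log (Real.log (x : ℝ)) →
        ‖(∑ n ∈ Finset.range (x + 1), (z : ℂ) ^ (∑ i, (((f i).eval (n : ℤ)).toNat.factorization.sum fun _ v => min v 2)))‖ ≤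
          A * (x : ℝ) * (Real.log (x : ℝ)) ^ ((k : ℝ) * ((z : ℂ).re - 1)) *
            Real.exp (C * ‖(z : ℂ) - 1‖ * Real.log (‖(z : ℂ) - 1‖ + 2)) := by
  rintro ⟨A, C₀, x₀, h⟩
  set x : ℕ := max x₀ 16 with hxdef
  have hx₀ : x₀ ≤ x := le_max_left _ _
  have hx16 : (16 : ℝ) ≤ x := by exact_mod_cast le_max_right x₀ 16
  obtain ⟨h23, -⟩ := two_le_three_loglog_of_sixteen_le hx16
  -- the budget at `z = 2`, `k = 1` is ONE real number `R`
  set R : ℝ := A * (x : ℝ) * (Real.log (x : ℝ)) ^ (((1 : ℕ) : ℝ) * ((2 : ℂ).re - 1)) *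
    Real.exp (C₀ * ‖(2 : ℂ) - 1‖ * Real.log (‖(2 : ℂ) - 1‖ + 2)) with hR
  obtain ⟨m, hm⟩ := pow_unbounded_of_one_lt R (by norm_num : (1 : ℝ) < 2)
  -- a squarefree `P` with `m` prime factors, placed at `n = x` by the shift `c = P − x`
  obtain ⟨S, hS, hcard⟩ := Nat.infinite_setOf_prime.exists_subset_card_eq m
  have hSp : ∀ p ∈ S, p.Prime := fun p hp => hS hp
  set P : ℕ := ∏ p ∈ S, p with hP
  have hPf : P.primeFactors = S := Nat.primeFactors_prod hSp
  set c : ℤ := (P : ℤ) - x with hc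
  have hz : ‖(2 : ℂ) - 1‖ ≤ 3 * Real.log (Real.log (x : ℝ)) := by
    rw [show (2 : ℂ) - 1 = 1 by norm_num, norm_one]; linarith
  have hmain := h 1 ![X + C c] (isBatemanHornSystem_fXadd c) x hx₀ 2 hz
  -- the left side is a sum of positive reals, at least its `n = x` term `2^{s(P)} ≥ 2^m`
  set e : ℕ → ℕ := fun n => ∑ i : Fin 1,
    ((((![X + C c] : Fin 1 → ℤ[X]) i).eval (n : ℤ)).toNat.factorization.sum fun _ v => min v 2) with he
  have hnorm : ‖∑ n ∈ Finset.range (x + 1), (2 : ℂ) ^ (e n)‖ = ∑ n ∈ Finset.range (x + 1), (2 : ℝ) ^ (e n) := by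
    have : (∑ n ∈ Finset.range (x + 1), (2 : ℂ) ^ (e n)) =
        ((∑ n ∈ Finset.range (x + 1), (2 : ℝ) ^ (e n) : ℝ) : ℂ) := by push_cast; rfl
    rw [this, Complex.norm_real, Real.norm_of_nonneg (Finset.sum_nonneg fun _ _ => by positivity)]
  have hval : (((X + C c : ℤ[X])).eval (x : ℤ)).toNat = P := by
    simp only [eval_add, eval_X, eval_C, hc, add_sub_cancel, Int.toNat_natCast]
  have hexp : m ≤ e x := by
    simp only [he, Fin.sum_univ_one, Matrix.cons_val_fin_one, hval]
    calc m = P.primeFactors.card := by rw [hPf, hcard]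
      _ ≤ _ := card_primeFactors_le_capped P
  have hterm : (2 : ℝ) ^ m ≤ ∑ n ∈ Finset.range (x + 1), (2 : ℝ) ^ (e n) := by
    have hxmem : x ∈ Finset.range (x + 1) := by simp
    exact (pow_le_pow_right₀ (by norm_num) hexp).trans
      (Finset.single_le_sum (f := fun n => (2 : ℝ) ^ (e n)) (fun n _ => by positivity) hxmem)
  change ‖∑ n ∈ Finset.range (x + 1), (2 : ℂ) ^ (e n)‖ ≤ R at hmain
  rw [hnorm] at hmain
  linarith

/-! ## REFUTED VARIANT 2: the cap at `2` is load-bearing -/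

/-- **The cap is load-bearing.**  With the UNCAPPED statistic `Ω_f(n) = Σ_i Σ_{p^v ∥ f_i(n)} v` in place of
`s_f(n) = Σ_i Σ min(v, 2)`, the disc majorant is FALSE already for `k = 1`, `f = (X)` (written `X + C 0`): the disc
`‖z − 1‖ ≤ 3 log log x` contains `z = 3` once `x ≥ 16`, where the budget is `A x (log x)^2 e^{2C log 4}`,
while the single term `n = 2^j ≤ x` contributes `3^{Ω(2^j)} = 3^j ≥ x^{log 3/log 2}/3`.  (At `x = 2^j`:
`3^j ≤ |A| e^{2C log 4} 2^j j²` fails for `j` large since `j²/(3/2)^j → 0`.)  This is the `|z| > 2`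
pole of the `Ω`-Euler factor `(1 − z/p^s)^{-1}` at `p = 2`; the capped statistic has polynomial local
factors and no such pole — any proof of the near leaf must use the cap (a TW-class argument with only
`|g(p^v)| ≤ |z|^v` cannot work on the whole disc). [folklore] -/
theorem not_discMajorantLog_uncapped :
    ¬ ∀ (k : ℕ) (f : Fin k → ℤ[X]), IsBatemanHornSystem f →
      ∃ A C : ℝ, ∃ x₀ : ℕ, ∀ x : ℕ, x₀ ≤ x → ∀ z : ℂ, ‖z - 1‖ ≤ 3 * Real.log (Real.log (x : ℝ)) →
        ‖(∑ n ∈ Finset.range (x + 1), (z : ℂ) ^ (∑ i, (((f i).eval (n : ℤ)).toNat.factorization.sum fun _ v => v)))‖ ≤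
          A * (x : ℝ) * (Real.log (x : ℝ)) ^ ((k : ℝ) * ((z : ℂ).re - 1)) *
            Real.exp (C * ‖(z : ℂ) - 1‖ * Real.log (‖(z : ℂ) - 1‖ + 2)) := by
  intro h
  obtain ⟨A, C₀, x₀, h⟩ := h 1 ![X + C (0 : ℤ)] (isBatemanHornSystem_fXadd 0)
  set E : ℝ := Real.exp (C₀ * 2 * Real.log (2 + 2)) with hE
  set K : ℝ := |A| * E with hK
  have hK0 : 0 ≤ K := by positivity
  have hK1 : 0 < K + 1 := by linarith
  -- choose `j ≥ max x₀ 4` with `j² (K+1) < (3/2)^j`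
  have hev : ∀ᶠ j : ℕ in atTop, (j : ℝ) ^ 2 / (3 / 2 : ℝ) ^ j < 1 / (K + 1) :=
    (tendsto_pow_const_div_const_pow_of_one_lt 2 (by norm_num : (1 : ℝ) < 3 / 2)).eventually
      (gt_mem_nhds (by positivity))
  obtain ⟨j, hj1, hj2⟩ := (hev.and (eventually_ge_atTop (max x₀ 4))).exists
  have hjx₀ : x₀ ≤ j := le_of_max_le_left hj2
  have hj4 : 4 ≤ j := le_of_max_le_right hj2
  set x : ℕ := 2 ^ j with hxdef
  have hjx : j ≤ x := Nat.lt_two_pow_self.le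
  have hx₀ : x₀ ≤ x := hjx₀.trans hjx
  have hx16 : (16 : ℝ) ≤ x := by
    have : 2 ^ 4 ≤ 2 ^ j := Nat.pow_le_pow_right two_pos hj4
    rw [hxdef]; exact_mod_cast this
  have hxpos : (0 : ℝ) < x := by linarith
  obtain ⟨h23, hlogx⟩ := two_le_three_loglog_of_sixteen_le hx16
  have hz : ‖(3 : ℂ) - 1‖ ≤ 3 * Real.log (Real.log (x : ℝ)) := by
    rw [show (3 : ℂ) - 1 = 2 by norm_num, Complex.norm_two]; exact h23
  have hmain := h x hx₀ 3 hz
  -- exponent sequence and the norm of the (positive) sum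
  set e : ℕ → ℕ := fun n => ∑ i : Fin 1,
    ((((![X + C (0 : ℤ)] : Fin 1 → ℤ[X]) i).eval (n : ℤ)).toNat.factorization.sum fun _ v => v) with he
  have hnorm : ‖∑ n ∈ Finset.range (x + 1), (3 : ℂ) ^ (e n)‖ = ∑ n ∈ Finset.range (x + 1), (3 : ℝ) ^ (e n) := by
    have : (∑ n ∈ Finset.range (x + 1), (3 : ℂ) ^ (e n)) =
        ((∑ n ∈ Finset.range (x + 1), (3 : ℝ) ^ (e n) : ℝ) : ℂ) := by push_cast; rfl
    rw [this, Complex.norm_real, Real.norm_of_nonneg (Finset.sum_nonneg fun _ _ => by positivity)]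
  -- the `n = x = 2^j` term is `3^j`
  have hexp : e x = j := by
    simp only [he, Fin.sum_univ_one, Matrix.cons_val_fin_one, eval_add, eval_X, eval_C, add_zero,
      Int.toNat_natCast]
    rw [hxdef]; exact uncapped_two_pow j
  have hterm : (3 : ℝ) ^ j ≤ ∑ n ∈ Finset.range (x + 1), (3 : ℝ) ^ (e n) := by
    have hxmem : x ∈ Finset.range (x + 1) := by simp
    have := Finset.single_le_sum (f := fun n => (3 : ℝ) ^ (e n)) (fun n _ => by positivity) hxmem
    simpa [hexp] using this
  -- the budget at `z = 3`: `A x (log x)^2 E ≤ K x j²`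
  change ‖∑ n ∈ Finset.range (x + 1), (3 : ℂ) ^ (e n)‖ ≤
    A * (x : ℝ) * (Real.log (x : ℝ)) ^ (((1 : ℕ) : ℝ) * ((3 : ℂ).re - 1)) *
      Real.exp (C₀ * ‖(3 : ℂ) - 1‖ * Real.log (‖(3 : ℂ) - 1‖ + 2)) at hmain
  rw [hnorm, show (3 : ℂ) - 1 = 2 by norm_num, Complex.norm_two] at hmain
  have hre : ((1 : ℕ) : ℝ) * ((3 : ℂ).re - 1) = ((2 : ℕ) : ℝ) := by simp; norm_num
  rw [hre, Real.rpow_natCast] at hmain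
  have hlogj : Real.log (x : ℝ) ≤ j := by
    rw [hxdef]; push_cast
    rw [Real.log_pow]
    have := Real.log_two_lt_d9
    have hj0 : (0 : ℝ) ≤ j := by positivity
    nlinarith
  have hlog2 : Real.log (x : ℝ) ^ 2 ≤ (j : ℝ) ^ 2 := pow_le_pow_left₀ hlogx.le hlogj 2
  have hxj : (x : ℝ) = (2 : ℝ) ^ j := by rw [hxdef]; push_cast; ring
  have hbudget : A * (x : ℝ) * Real.log (x : ℝ) ^ 2 * E ≤ K * (2 : ℝ) ^ j * (j : ℝ) ^ 2 := by
    rw [hK, ← hxj]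
    have hE0 : 0 ≤ E := (Real.exp_pos _).le
    calc A * (x : ℝ) * Real.log (x : ℝ) ^ 2 * E ≤ |A| * (x : ℝ) * Real.log (x : ℝ) ^ 2 * E := by
          gcongr; exact le_abs_self A
      _ ≤ |A| * (x : ℝ) * (j : ℝ) ^ 2 * E := by gcongr
      _ = |A| * E * x * (j : ℝ) ^ 2 := by ring
  -- `j² (K+1) < (3/2)^j`, hence `K 2^j j² < 3^j`
  have h32 : (0 : ℝ) < (3 / 2 : ℝ) ^ j := by positivity
  have hj1' : (j : ℝ) ^ 2 * (K + 1) < (3 / 2 : ℝ) ^ j := by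
    rw [div_lt_div_iff₀ h32 hK1, one_mul] at hj1; linarith
  have h3j : (3 : ℝ) ^ j = (3 / 2 : ℝ) ^ j * (2 : ℝ) ^ j := by rw [← mul_pow]; norm_num
  have h2j : (0 : ℝ) < (2 : ℝ) ^ j := by positivity
  have hlt : K * (2 : ℝ) ^ j * (j : ℝ) ^ 2 < (3 : ℝ) ^ j := by
    rw [h3j]
    have : K * (2 : ℝ) ^ j * (j : ℝ) ^ 2 ≤ (j : ℝ) ^ 2 * (K + 1) * (2 : ℝ) ^ j := by nlinarith [sq_nonneg (j : ℝ)]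
    calc K * (2 : ℝ) ^ j * (j : ℝ) ^ 2 ≤ (j : ℝ) ^ 2 * (K + 1) * (2 : ℝ) ^ j := this
      _ < (3 / 2 : ℝ) ^ j * (2 : ℝ) ^ j := mul_lt_mul_of_pos_right hj1' h2j
  linarith

/-! ## REFUTED APPROACH 3: no proof through the triangle inequality -/

/-- ENGINE (real-valued left side).  For `k ≥ 1`, no quantity `F x z` with `F x (−1) = x + 1` obeys the
budget of `DiscMajorantLog`: at `z = −1` (in the disc once `x ≥ 16`) the budget is
`A e^{2C log 4} x (log x)^{−2k}`, and `(x+1)(log x)^{2} ≤ (x+1)(log x)^{2k} ≤ K x` fails for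
`log x ≥ |K| + 1`. [folklore] -/
theorem budget_false_of_eq_at_neg_one {k : ℕ} (hk : 1 ≤ k) {F : ℕ → ℂ → ℝ}
    (hF : ∀ x : ℕ, F x (-1) = (x : ℝ) + 1) :
    ¬ ∃ A C : ℝ, ∃ x₀ : ℕ, ∀ x : ℕ, x₀ ≤ x → ∀ z : ℂ, ‖z - 1‖ ≤ 3 * Real.log (Real.log (x : ℝ)) →
      F x z ≤ A * (x : ℝ) * (Real.log (x : ℝ)) ^ ((k : ℝ) * ((z : ℂ).re - 1)) *
          Real.exp (C * ‖(z : ℂ) - 1‖ * Real.log (‖(z : ℂ) - 1‖ + 2)) := by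
  -- adapted from Theorems/DiscMajorantLog/Negative/FalseWithoutPairwise.lean
  rintro ⟨A, C, x₀, h⟩
  set E : ℝ := Real.exp (C * 2 * Real.log (2 + 2)) with hE
  set K : ℝ := A * E with hK
  set x : ℕ := max (max x₀ 16) ⌈Real.exp (|K| + 1)⌉₊ with hxdef
  have hx₀ : x₀ ≤ x := le_trans (le_max_left _ _) (le_max_left _ _)
  have hx16 : (16 : ℝ) ≤ x := by exact_mod_cast le_trans (le_max_right x₀ 16) (le_max_left _ _)
  have hxpos : (0 : ℝ) < x := by linarith
  have hxK : Real.exp (|K| + 1) ≤ x := le_trans (Nat.le_ceil _) (by exact_mod_cast le_max_right _ _)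
  obtain ⟨h23, hlogx⟩ := two_le_three_loglog_of_sixteen_le hx16
  have hlogK : |K| + 1 ≤ Real.log x := by rw [Real.le_log_iff_exp_le hxpos]; exact hxK
  have hlog1 : 1 ≤ Real.log x := by linarith [abs_nonneg K]
  have hlog2 : Real.log x ≤ Real.log x ^ 2 := le_self_pow₀ hlog1 (by norm_num)
  have hpow2k : Real.log (x : ℝ) ^ 2 ≤ Real.log x ^ (2 * k) := pow_le_pow_right₀ hlog1 (by omega)
  have hz : ‖(-1 : ℂ) - 1‖ ≤ 3 * Real.log (Real.log (x : ℝ)) := by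
    rw [show (-1 : ℂ) - 1 = -2 by norm_num, norm_neg, Complex.norm_two]; exact h23
  have hmain := h x hx₀ (-1) hz
  rw [hF x, show (-1 : ℂ) - 1 = -2 by norm_num, norm_neg, Complex.norm_two] at hmain
  have hre : (k : ℝ) * ((-1 : ℂ).re - 1) = -((2 * k : ℕ) : ℝ) := by simp; ring
  rw [hre, Real.rpow_neg hlogx.le, Real.rpow_natCast] at hmain
  have hpow : 0 < Real.log (x : ℝ) ^ (2 * k) := pow_pos hlogx _
  have h1 : ((x : ℝ) + 1) * Real.log (x : ℝ) ^ (2 * k) ≤ K * x := by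
    have := mul_le_mul_of_nonneg_right hmain hpow.le
    rw [hK]
    calc ((x : ℝ) + 1) * Real.log (x : ℝ) ^ (2 * k)
        ≤ A * x * (Real.log (x : ℝ) ^ (2 * k))⁻¹ * E * Real.log (x : ℝ) ^ (2 * k) := this
      _ = A * E * x := by field_simp
  have h2 : ((x : ℝ) + 1) * Real.log (x : ℝ) ^ 2 ≤ K * x :=
    (mul_le_mul_of_nonneg_left hpow2k (by positivity)).trans h1
  rcases le_or_gt K 0 with hK0 | hK0
  · have : ((x : ℝ) + 1) * Real.log (x : ℝ) ^ 2 ≤ 0 :=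
      h2.trans (mul_nonpos_of_nonpos_of_nonneg hK0 hxpos.le)
    nlinarith
  · have h3 : Real.log (x : ℝ) ^ 2 ≤ K := by
      by_contra hcon
      push Not at hcon
      nlinarith
    have : K ≤ |K| := le_abs_self K
    linarith

/-- **The triangle inequality is hopeless — for EVERY system, not only Bateman–Horn ones.**  For `k ≥ 1`
and any `f`, the trivial majorant `Σ_{n≤x} ‖z‖^{s_f(n)}` of `‖S_x(z)‖` does NOT fit the budget of the
crux: at `z = −1` it equals `x + 1` against `O(x (log x)^{−2k})`.  More generally at `z = e^{iθ}` the crux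
asks the saving `(log x)^{k(1 − cos θ)}` and at `z = −t` the saving `(log x)^{2kt}` over `Σ_n ‖z‖^{s_f(n)}`:
all of it must come from cancellation among the phases of `z^{s_f(n)}` (Halász-type decay along `f` on
the right half-disc, tilted Chowla along `f` on the left), none from sizes. [folklore] -/
theorem not_discMajorantLog_abs {k : ℕ} (hk : 1 ≤ k) (f : Fin k → ℤ[X]) :
    ¬ ∃ A C : ℝ, ∃ x₀ : ℕ, ∀ x : ℕ, x₀ ≤ x → ∀ z : ℂ, ‖z - 1‖ ≤ 3 * Real.log (Real.log (x : ℝ)) →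
      (∑ n ∈ Finset.range (x + 1), ‖z‖ ^ (∑ i, (((f i).eval (n : ℤ)).toNat.factorization.sum fun _ v => min v 2))) ≤
        A * (x : ℝ) * (Real.log (x : ℝ)) ^ ((k : ℝ) * ((z : ℂ).re - 1)) *
          Real.exp (C * ‖(z : ℂ) - 1‖ * Real.log (‖(z : ℂ) - 1‖ + 2)) :=
  budget_false_of_eq_at_neg_one hk
    (F := fun x z => ∑ n ∈ Finset.range (x + 1),
      ‖z‖ ^ (∑ i, (((f i).eval (n : ℤ)).toNat.factorization.sum fun _ v => min v 2)))
    (fun x => by simp)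

end Summit.Parity.BatemanHorn.Theorems.DiscMajorantLog.Negative
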